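import Summits.NavierStokesRegularity.NavierStokesRegularity.Theses.QuantisedSymmetry
import Summits.NavierStokesRegularity.NavierStokesRegularity.Theses.DssFarFieldSlaving
import Summits.NavierStokesRegularity.NavierStokesRegularity.Theses.Blowup
import Summits.NavierStokesRegularity.NavierStokesRegularity.Theses.AncientHullSteering
import Summits.NavierStokesRegularity.NavierStokesRegularity.Theorems.QuantisedSymmetryPolyhedralTruncationBridge
import Summits.NavierStokesRegularity.NavierStokesRegularity.Theorems.QuantisedSymmetryLiouvilleKillsProfile
import Summits.NavierStokesRegularity.NavierStokesRegularity.Theorems.DssFarFieldSlavingDssTruncationBridge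
import Literature.Analysis.FluidPDE.SelfSimilarProofs
import HarnessLib

/-!
# Strategist sketch s19-g16 for crux `PolyhedralDssProfileExists` (stmt-NavierStokesRegularity-1404)

Companion to `STRATEGY-CENSUS-s19.md` (family `-s`, gen 16, independent census).  Everything
here is sorry-free bookkeeping that makes the census claims kernel-checked:

* §0 `crux_decides` — the crux ALONE proves `¬ NavierStokesRegularity` (the other two binders of
  the route's `closes` are landed theorems), i.e. the crux is summit-deciding (Clay (C)).
* §1 WEAKER INTERMEDIATES read off the summit statement.  Each `Y` with `X → Y` that can re-glue
  `closes` is shown to be summit-deciding by landed theorems as well (`hub_decides`,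
  `blowupExists_decides`), and the one weaker `Y` that is not (`TypeIAncientProfileExists`) only
  closes through the OPEN bridge `AncientHullSteering.AncientTruncationBridge` (stmt-20185)
  (`typeIAncient_decides_of_openBridge`), i.e. re-gluing on it is route AncientHullSteering.
* §2 the best typed DECOMPOSITION found (trace split D-T): `TraceProfileExists` (T1) and
  `TraceBackwardUniqueness` (T2) with the assembly `crux_of_traceSplit : T1 → T2 → X` PROVED.
  The census explains why T1 keeps the whole existence content and why T2 is itself open /
  plausibly false (backward uniqueness across a Type-I singular time).
-/

namespace Summit.NavierStokesRegularity.NavierStokesRegularity.Cruxes.PolyhedralDssProfileExists.S19g16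

open MeasureTheory Filter Topology
open Literature.Analysis.FluidPDE
open Summit.NavierStokesRegularity.NavierStokesRegularity.Theses

/-- Shorthand for `ℝ³`. -/
abbrev R3 : Type := EuclideanSpace ℝ (Fin 3)

/-! ## §0 The crux decides the summit by itself -/

/-- `PolyhedralDssProfileExists ⊢ ¬ NavierStokesRegularity`: the route's deciding theorem with its
two other binders discharged by the landed `quantisedSymmetry_polyhedralTruncationBridge_proof`
(stmt-11331) and `ClayUniqueness_holds` (stmt-0153). -/
theorem crux_decides (hX : QuantisedSymmetry.PolyhedralDssProfileExists) :
    ¬ _root_.NavierStokesRegularity :=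
  QuantisedSymmetry.closes hX Theorems.quantisedSymmetry_polyhedralTruncationBridge_proof
    QuantisedSymmetry.ClayUniqueness_holds

/-! ## §1 Weaker intermediates and their status -/

/-- `X → BlowupTypeIDssProfile` (stmt-0155, the hub crux of routes Blowup / DssFarFieldSlaving):
forget the symmetry group, take `R = 1`. -/
theorem hub_of_crux (hX : QuantisedSymmetry.PolyhedralDssProfileExists) :
    DssFarFieldSlaving.BlowupTypeIDssProfile := by
  obtain ⟨G, -, -, -, c, hc, u, hanc, hmeas, hdss, hdec, -, hnt⟩ := hX
  intro hL
  exact hnt ((hL c).1 hc u hanc hmeas hdss hdec)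

/-- `BlowupExists` (X5a of route Blowup: a rapidly decaying datum with finite maximal lifespan) is
summit-deciding by the landed `BlowupClayUniqueness_holds` (stmt-0153). -/
theorem blowupExists_decides (h : Blowup.BlowupExists) : ¬ _root_.NavierStokesRegularity :=
  Blowup.closes h Blowup.BlowupClayUniqueness_holds

/-- … but `BlowupTypeIDssProfile` is summit-deciding too, by LANDED theorems
(`dssTruncationBridge_proof` = stmt-14477, then route Blowup's `closes` with
`BlowupClayUniqueness_holds` = stmt-0153; equivalently `DssFarFieldSlavingAssembly_proof`). -/
theorem hub_decides (hY : DssFarFieldSlaving.BlowupTypeIDssProfile) :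
    ¬ _root_.NavierStokesRegularity :=
  blowupExists_decides (Theorems.dssTruncationBridge_proof hY)

/-- `X → BlowupExists` (through the hub). -/
theorem blowupExists_of_crux (hX : QuantisedSymmetry.PolyhedralDssProfileExists) :
    Blowup.BlowupExists :=
  Theorems.dssTruncationBridge_proof (hub_of_crux hX)

/-- `X → ¬ PolyhedralTypeILiouville` (W3: negation of the route's kill switch stmt-1405), by the
landed `quantisedSymmetry_liouvilleKillsProfile_proof` (stmt-1408). -/
theorem notLiouville_of_crux (hX : QuantisedSymmetry.PolyhedralDssProfileExists) :
    ¬ QuantisedSymmetry.PolyhedralTypeILiouville :=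
  fun hL => Theorems.quantisedSymmetry_liouvilleKillsProfile_proof hL hX

/-- The weakest intermediate readable off the summit side: a nontrivial Type-I-decaying ancient
mild solution exists (no symmetry, no self-similarity) — verbatim the hypothesis of
`AncientHullSteering.AncientTruncationBridge` (stmt-20185, OPEN). -/
def TypeIAncientProfileExists : Prop :=
  ∃ u : ℝ → R3 → R3, IsAncientMildSolution 1 u ∧ (∀ t < 0, AEStronglyMeasurable (u t) volume) ∧
    (∃ C₀ : ℝ, HasTypeIDecay C₀ u) ∧ ¬ (∀ t < 0, u t =ᵐ[volume] 0)

/-- `X → TypeIAncientProfileExists` (drop `G` and `c`). -/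
theorem typeIAncient_of_crux (hX : QuantisedSymmetry.PolyhedralDssProfileExists) :
    TypeIAncientProfileExists := by
  obtain ⟨G, -, -, -, c, hc, u, hanc, hmeas, hdss, hdec, -, hnt⟩ := hX
  exact ⟨u, hanc, hmeas, hdec, hnt⟩

/-- Re-gluing `closes` on `TypeIAncientProfileExists` needs the OPEN bridge stmt-20185; with it the
route is literally route AncientHullSteering. -/
theorem typeIAncient_decides_of_openBridge (hW : TypeIAncientProfileExists)
    (hR : AncientHullSteering.AncientTruncationBridge) : ¬ _root_.NavierStokesRegularity := by
  obtain ⟨ν, hν, T, hT, u, p, hmax, hLH, hdecay, -⟩ := hR hW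
  exact blowupExists_decides ⟨ν, hν, T, hT, u, p, hmax, hLH, hdecay⟩

/-! ## §2 The trace split D-T (typed, assembly proved) -/

/-- Admissible symmetry group (verbatim from the crux): finite, in `SO(3)`, irreducible on `ℝ³`. -/
def IsAdmissibleGroup (G : Subgroup (R3 ≃ₗᵢ[ℝ] R3)) : Prop :=
  Finite G ∧ (∀ g ∈ G, LinearMap.det (g.toLinearEquiv : R3 →ₗ[ℝ] R3) = 1) ∧
    (∀ V : Submodule ℝ R3, (∀ g ∈ G, ∀ v ∈ V, g v ∈ V) → V = ⊥ ∨ V = ⊤)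

/-- **T1** (`TraceProfileExists`): a nontrivial `G`-equivariant Type-I ancient mild solution with
continuous slices, normalised to `0` for `t ≥ 0`, whose pointwise blow-up trace
`V₀(x) = lim_{t→0⁻} u(t,x)` exists off the origin and is `λ`-DSS-homogeneous,
`λ V₀(λ x) = V₀(x)`.  No periodicity of the Leray orbit is asked. -/
def TraceProfileExists : Prop :=
  ∃ G : Subgroup (R3 ≃ₗᵢ[ℝ] R3), IsAdmissibleGroup G ∧ ∃ c : ℝ, 1 < c ∧ ∃ u : ℝ → R3 → R3,
    IsAncientMildSolution 1 u ∧ (∀ t < 0, Continuous (u t)) ∧ (∀ t, 0 ≤ t → u t = 0) ∧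
    (∃ C₀ : ℝ, HasTypeIDecay C₀ u) ∧ (∀ g ∈ G, ∀ t x, u t (g x) = g (u t x)) ∧
    ¬ (∀ t < 0, u t =ᵐ[volume] 0) ∧
    ∃ V₀ : R3 → R3, (∀ x, x ≠ 0 → Tendsto (fun t => u t x) (𝓝[<] 0) (𝓝 (V₀ x))) ∧
      ∀ x, c • V₀ (c • x) = V₀ x

/-- **T2** (`TraceBackwardUniqueness`): two Type-I ancient mild solutions with continuous slices
and the same pointwise blow-up trace off the origin coincide for `t < 0` (backward uniqueness
ACROSS the Type-I singular time; not covered by Escauriaza–Seregin–Šverák, whose Carleman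
inequalities need bounded lower-order coefficients). -/
def TraceBackwardUniqueness : Prop :=
  ∀ u v : ℝ → R3 → R3, IsAncientMildSolution 1 u → IsAncientMildSolution 1 v →
    (∀ t < 0, Continuous (u t)) → (∀ t < 0, Continuous (v t)) →
    (∃ C₀ : ℝ, HasTypeIDecay C₀ u) → (∃ C₀ : ℝ, HasTypeIDecay C₀ v) →
    (∀ x, x ≠ 0 → ∃ V : R3, Tendsto (fun t => u t x) (𝓝[<] 0) (𝓝 V) ∧
      Tendsto (fun t => v t x) (𝓝[<] 0) (𝓝 V)) →
    ∀ t < 0, u t = v t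

/-- `t ↦ c² t` maps `𝓝[<] 0` to `𝓝[<] 0`. -/
theorem tendsto_sq_mul_nhdsLT (c : ℝ) (hc : 0 < c) :
    Tendsto (fun t : ℝ => c ^ 2 * t) (𝓝[<] (0 : ℝ)) (𝓝[<] (0 : ℝ)) := by
  refine tendsto_nhdsWithin_of_tendsto_nhds_of_eventually_within _ ?_ ?_
  · have h : Tendsto (fun t : ℝ => c ^ 2 * t) (𝓝 0) (𝓝 (c ^ 2 * 0)) :=
      ((continuous_const.mul continuous_id).tendsto 0)
    rw [mul_zero] at h
    exact h.mono_left nhdsWithin_le_nhds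
  · filter_upwards [self_mem_nhdsWithin] with t ht
    simp only [Set.mem_Iio] at ht ⊢
    have hc2 : (0 : ℝ) < c ^ 2 := by positivity
    exact mul_neg_of_pos_of_neg hc2 ht

/-- **Assembly of D-T (proved)**: `T1 → T2 → PolyhedralDssProfileExists`.  The rescaled field
`u_λ = nsRescale λ u` is again a Type-I ancient mild solution (`IsAncientMildSolution.nsRescale_holds`,
`HasTypeIDecay.nsRescale`) with the SAME trace (homogeneity of `V₀`), so T2 forces `u_λ = u` on
`t < 0`; the junk normalisation gives it for `t ≥ 0`; hence `u` is `λ`-DSS and is the profile. -/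
theorem crux_of_traceSplit (h1 : TraceProfileExists) (h2 : TraceBackwardUniqueness) :
    QuantisedSymmetry.PolyhedralDssProfileExists := by
  obtain ⟨G, ⟨hfin, hdet, hirr⟩, c, hc, u, hanc, hcont, hjunk, hdec, heqv, hnt, V₀, hV, hhom⟩ := h1
  have hc0 : 0 < c := by linarith
  have hvanc : IsAncientMildSolution 1 (nsRescale c u) :=
    IsAncientMildSolution.nsRescale_holds hanc one_pos hc0
  have hvcont : ∀ t < 0, Continuous (nsRescale c u t) := by
    intro t ht
    have hct : c ^ 2 * t < 0 := mul_neg_of_pos_of_neg (by positivity) ht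
    have h : Continuous fun x : R3 => c • u (c ^ 2 * t) (c • x) :=
      ((hcont _ hct).comp (continuous_const_smul c)).const_smul c
    have hfun : nsRescale c u t = fun x : R3 => c • u (c ^ 2 * t) (c • x) := by
      funext x; exact nsRescale_apply c u t x
    rw [hfun]; exact h
  have hvdec : ∃ C₀ : ℝ, HasTypeIDecay C₀ (nsRescale c u) :=
    hdec.imp fun C₀ h => h.nsRescale hc0
  have htrace : ∀ x, x ≠ 0 → ∃ V : R3, Tendsto (fun t => nsRescale c u t x) (𝓝[<] 0) (𝓝 V) ∧
      Tendsto (fun t => u t x) (𝓝[<] 0) (𝓝 V) := by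
    intro x hx
    refine ⟨V₀ x, ?_, hV x hx⟩
    have hcx : c • x ≠ 0 := smul_ne_zero hc0.ne' hx
    have key := ((hV (c • x) hcx).comp (tendsto_sq_mul_nhdsLT c hc0)).const_smul c
    rw [hhom x] at key
    have hfun : (fun t => nsRescale c u t x) = fun t => c • u (c ^ 2 * t) (c • x) := by
      funext t; exact nsRescale_apply c u t x
    rw [hfun]
    exact key
  have heq : ∀ t < 0, nsRescale c u t = u t :=
    h2 (nsRescale c u) u hvanc hanc hvcont hcont hvdec hdec htrace
  refine ⟨G, hfin, hdet, hirr, c, hc, u, hanc, ?_, ?_, hdec, heqv, hnt⟩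
  · exact fun t ht => (hcont t ht).aestronglyMeasurable
  · show nsRescale c u = u
    funext t x
    by_cases ht : t < 0
    · rw [heq t ht]
    · have ht' : 0 ≤ t := not_lt.mp ht
      have hct : 0 ≤ c ^ 2 * t := mul_nonneg (by positivity) ht'
      rw [nsRescale_apply, hjunk _ hct, hjunk _ ht']
      simp

end Summit.NavierStokesRegularity.NavierStokesRegularity.Cruxes.PolyhedralDssProfileExists.S19g16
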